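import Literature.Geometry.Symplectic.SteinPALF
import Literature.Topology.FourManifolds.RegularFibre
import HarnessLib

/-!
# The open regular fibres of a PALF as smooth surfaces

Topic `Literature/Geometry/Symplectic` (fact seat
`provefact-Literature.Geometry.Symplectic.Oba2016_s-add47373d4`; Kas' handlebody of a Lefschetz
fibration over the disc — Kas 1980, Gompf–Stipsicz 1999 §8.2, Oba 2016 §2.2 — needs the regular
fibre as a surface carrying a Morse function).  Everything is proved; no definitions, no named
facts.

For a PALF `P : PALF o b` on the compact 4-manifold with boundary `W` (`SteinPALF.lean`) and a
value `c` which is not a critical value, the part of the fibre `f⁻¹(c)` in the interior of `W`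
is a regular fibre in the sense of `RegularFibre.lean` (`PALF.isRegularFibreOn_interior`:
`f` is a submersion off `crit`, `P.submersion`), hence (`Literature.Topology.FourManifolds.RegularFibreOn`)
a smooth surface without boundary, Hausdorff and second countable, smoothly embedded in `W`
(`PALF.exists_isSmoothEmbedding_range_eq_fibre_inter_interior`).

## References

* A. Kas, *On the handlebody decomposition associated to a Lefschetz fibration*, Pacific J.
  Math. 89 (1980), §1. [Kas1980]
* R. E. Gompf, A. I. Stipsicz, *4-Manifolds and Kirby Calculus*, GSM 20 (1999), §8.1–8.2.
  [GompfStipsiczGSM1999]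
* T. Oba, *Stein fillings of homology 3-spheres and mapping class groups*, Geom. Dedicata 183
  (2016); arXiv:1407.5257, §2.2. [Oba2016]
-/

open scoped Manifold ContDiff Topology
open Set Function

noncomputable section

namespace Literature.Geometry.Symplectic

open Literature.Topology.FourManifolds

universe u

variable {W : Type u} [TopologicalSpace W] [ChartedSpace (EuclideanHalfSpace 4) W]
  [IsManifold (𝓡∂ 4) ∞ W]
  {o : SmoothOrientation (𝓡∂ 4) W} {b : BoundaryData (𝓡∂ 4) W (𝓡 3)} (P : PALF o b)

namespace PALF

/-- **The open regular fibre of a PALF is a regular fibre** (`IsRegularFibreOn`, codimension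
`2` in dimension `4`, on the open set `Int W`): for `c` not a critical value, every point of
`f⁻¹(c) ∩ Int W` is an interior point at which `df` is onto (`P.submersion`).
[cite: Kas1980, §1] -/
theorem isRegularFibreOn_interior {c : EuclideanSpace ℝ (Fin 2)} (hc : c ∉ P.f '' ↑P.crit) :
    IsRegularFibreOn (𝓡∂ 4) (show 2 + 2 = 4 from rfl) P.f c ((𝓡∂ 4).interior W) where
  isOpen := (𝓡∂ 4).isOpen_interior (M := W) (n := ∞) (by simp)
  contMDiff := P.contMDiff
  isInteriorPoint := fun _ hx _ => hx
  surjective_mfderiv := fun x _ hfx => P.submersion x fun hxc => hc ⟨x, hxc, hfx⟩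
  exists_appendCLE_mem_interior :=
    ⟨EuclideanSpace.single 0 1, appendCLE_single_zero_mem_interior_range _⟩

/-- **The open regular fibre of a PALF is a smooth surface smoothly embedded in `W`**
(existential form): for `c` not a critical value there is a smooth `2`-manifold `L` without
boundary (Hausdorff, second countable) and a smooth embedding `e : L → W` with image
`f⁻¹(c) ∩ Int W` — namely `L = RegularFibreOn (P.isRegularFibreOn_interior hc)`.
[cite: Kas1980, §1] -/
theorem exists_isSmoothEmbedding_range_eq_fibre_inter_interior [T2Space W]
    [SecondCountableTopology W] {c : EuclideanSpace ℝ (Fin 2)} (hc : c ∉ P.f '' ↑P.crit) :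
    ∃ (L : Type u) (_ : TopologicalSpace L) (_ : T2Space L) (_ : SecondCountableTopology L)
      (_ : ChartedSpace (EuclideanSpace ℝ (Fin 2)) L) (_ : IsManifold (𝓡 2) ∞ L) (e : L → W),
      Manifold.IsSmoothEmbedding (𝓡 2) (𝓡∂ 4) ∞ e ∧
        range e = P.f ⁻¹' {c} ∩ (𝓡∂ 4).interior W :=
  (P.isRegularFibreOn_interior hc).exists_isSmoothEmbedding_range_eq

/-- The critical values of a PALF form a finite set, so regular values are dense: every
nonempty open set of the base contains a non-critical value. [folklore] -/
theorem exists_not_mem_image_crit {U : Set (EuclideanSpace ℝ (Fin 2))} (hU : IsOpen U)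
    (hne : U.Nonempty) : ∃ c ∈ U, c ∉ P.f '' ↑P.crit := by
  have hfin : (P.f '' ↑P.crit).Finite := P.crit.finite_toSet.image _
  by_contra h
  push Not at h
  have hsub : U ⊆ P.f '' ↑P.crit := fun c hc => h c hc
  have hUfin : U.Finite := hfin.subset hsub
  obtain ⟨c, hc⟩ := hne
  -- a nonempty open subset of `ℝ²` is infinite
  have hinf : U.Infinite := by
    obtain ⟨ε, hε, hball⟩ := Metric.isOpen_iff.1 hU c hc
    haveI : Infinite (Set.Ioo (0 : ℝ) ε) := (Set.Ioo_infinite hε).to_subtype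
    refine Set.infinite_of_injective_forall_mem (f := fun t : Set.Ioo (0 : ℝ) ε =>
      c + (t : ℝ) • EuclideanSpace.single (0 : Fin 2) (1 : ℝ)) ?_ ?_
    · intro t t' htt'
      have h1 := congrArg (fun v : EuclideanSpace ℝ (Fin 2) => v 0) htt'
      simp only [PiLp.add_apply, PiLp.smul_apply, PiLp.single_apply, if_true, smul_eq_mul,
        mul_one, add_right_inj] at h1
      exact Subtype.ext h1
    · intro t
      apply hball
      rw [Metric.mem_ball, dist_eq_norm, add_sub_cancel_left, norm_smul, Real.norm_of_nonneg t.2.1.le]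
      simp [t.2.2]
  exact hinf hUfin

end PALF

end Literature.Geometry.Symplectic

end
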